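import Literature.Topology.FourManifolds.SeamBicollar
import Literature.Topology.FourManifolds.FlatCollarTransplant
import Literature.Topology.FourManifolds.RadialStretch
import Literature.Topology.FourManifolds.FramedTubularNbhd
import HarnessLib

/-!
# Seam-adapted gluing witnesses exist (discharge of `exists_seamAdaptedWitnesses`)

This file proves the named fact `Literature.Topology.FourManifolds.exists_seamAdaptedWitnesses`
(`CorkDecompositionSplittingProof.lean`, §1): if `X = A ∪_φ B` is glued from smooth manifolds with
boundary along `φ : ∂A ≅ ∂B` (`Literature.Topology.FourManifolds.IsBoundaryGluing`) and
`kA : ℝᵐ₊ ↪ A`, `kB : ℝᵐ₊ ↪ B` are half-discs whose flat faces correspond under `φ`, then the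
gluing admits witnesses `(jA, jB)` for which `jA ∘ kA` and `jB ∘ kB ∘ r` (`r` the reflection in the
boundary hyperplane) fit together to a smooth disc `i : ℝᵐ ↪ X` straddling the seam
(`Literature.Topology.FourManifolds.exists_seamAdaptedWitnesses_holds`). This is the
*compatibility (uniqueness) of collars* in Hirsch's proof of the uniqueness of the smooth structure
on a gluing (*Differential Topology* (1976), Ch. 8, §1, Thm. 1.9 with Thm. 1.8, and §2; Munkres,
*Elementary Differential Topology* (1966), §6).

With it, the cork decomposition theorem `Literature.Topology.FourManifolds.corkDecomposition`
(`CorkTwist.lean`; Curtis–Freedman–Hsiang–Stong 1996, Matveyev 1996) depends on a single named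
fact, Matveyev's Theorem part 1 together with the "Fact" of the proof of part 2
(`Literature.Topology.FourManifolds.Matveyev1996_partOne_and_fact`, the 5-dimensional h-cobordism
and Kirby-calculus content): `Literature.Topology.FourManifolds.corkDecomposition_of_partOne_and_fact`.

## The proof

All analytic ingredients are in the tree; this file assembles them.

* §1–§2 Euclidean preliminaries (flat discs `{w 0 = 0, ‖tail w‖ ≤ R}` are compact, open sets
  containing them contain closed boxes; an injective `C^∞` map with invertible derivatives on an
  open set of a Banach space is a diffeomorphism onto an open set).
* §3 **The tangential cut-off** (`exists_halfSpaceDiffeomorph_of_flatCollarGerm`). A *flat collar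
  germ* is a `C^∞` diffeomorphism `M₀` between open subsets of `ℝᵏ⁺¹` defined near a flat disc,
  fixing the hyperplane pointwise and carrying the upper side to the upper side. Its derivative at
  a hyperplane point is the identity on the hyperplane and has *positive* normal–normal entry
  (`fderiv_germ_upNormal_pos`: nonnegative by Fermat's theorem on the half space, Mathlib
  `IsLocalMinOn.hasFDerivWithinAt_nonneg`, nonzero by invertibility). Hence the cut-off
  `μ = id + χ(tail)·(M₀ - id)` is again a local diffeomorphism along the hyperplane (its derivative
  `(1 - χ) id + χ DM₀` is injective), injective near a large flat disc
  (`exists_isOpen_injOn_of_isCompact`), with `(μ w) 0 > 0` for `w 0 > 0` (a convex combination),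
  i.e. a *supported flat collar* in the sense of `FlatCollarTransplant.lean`, whose main theorem
  `FlatCollar.IsSupportedFlatCollar.exists_diffeomorph` turns it into a diffeomorphism `Θ` of the
  closed half space equal to `M₀` near the face, to the identity far out, fixing the hyperplane.
* §4 Transport of a compactly supported diffeomorphism of the half space along a half-disc
  `kB : ℝᵐ₊ ↪ B` to a diffeomorphism `β` of `B` (`embTransportDiffeomorph`, the identity off the
  image; cf. the tree's `chartTransport`).
* §5–§6 Local diffeomorphisms from local agreement with partial diffeomorphisms; the reflection
  `r` as a linear isomorphism.
* §7 **The main theorem** (`exists_seamAdapted_of_isBoundaryGluing`). Take any witnesses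
  `(jA, jB)`; bicollar the seam along `jA ∘ kA` and along `jB ∘ kB` (`exists_seamBicollar`,
  `SeamBicollar.lean`: two-sided extensions `K`, `K_B` seeing `jA(A)`, resp. `jB(B)`, exactly from
  above). The comparison germ `M₀ = K_B⁻¹ ∘ K ∘ r` is a flat collar germ (it fixes the hyperplane
  because the faces of `kA`, `kB` correspond under the seam relation; it preserves the upper side
  because a point strictly below the seam of `K` is not in `jA(A)`, hence in `jB(B)`, hence weakly
  above the seam of `K_B`, and not on it). With `Θ`, `β` as above, `jB' = jB ∘ β` is again a
  witness (`β` fixes `∂B` pointwise), and `i₀ = jA ∘ kA ∪ jB' ∘ kB ∘ r` coincides with `K` near the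
  seam (`jB' ∘ kB ∘ r = jB ∘ kB ∘ M₀ ∘ r = K_B ∘ K_B⁻¹ ∘ K` there), with `K` above and with seam
  charts of `(jB', kB)` below: an injective local diffeomorphism on the ball of radius `3`, which
  the radial stretch `ℝᵐ ≅ B(0, 3)` (`RadialStretch.lean`) reparametrises into the required disc
  (a smooth embedding with open range by `isSmoothEmbedding_of_isLocalDiffeomorph`).

## Main statements

* `exists_halfSpaceDiffeomorph_of_flatCollarGerm`: flat collar germs extend, after restriction to
  a neighbourhood of the face, to compactly supported diffeomorphisms of the half space.
* `exists_seamAdapted_of_isBoundaryGluing`, `exists_seamAdaptedWitnesses_holds`: the fact.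
* `corkDecomposition_of_partOne_and_fact`:
  `Matveyev1996_partOne_and_fact → corkDecomposition`.

## References

* M. W. Hirsch, *Differential Topology*, GTM 33, Springer (1976), Ch. 8, §1, Thm. 1.8 (uniqueness
  of collars / ambient tubular neighbourhoods), Thm. 1.9 (smoothing a gluing) and their proofs,
  pp. 181–182; §2 (gluing), p. 184. [HirschDT1976]
* J. R. Munkres, *Elementary Differential Topology*, Ann. of Math. Studies 54 (1966), §6.
  [Munkres1966]
* R. Matveyev, *A decomposition of smooth simply-connected h-cobordant 4-manifolds*,
  J. Differential Geom. 44 (1996), 571–582; arXiv:dg-ga/9505001 (Theorem; proof of part 2, fig. 2).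
  [Matveyev1996]
-/

open scoped Manifold ContDiff Topology
open Set Function Metric Filter

noncomputable section

namespace Literature.Topology.FourManifolds

/-- Local notation: `𝔼 n` is the model Euclidean space `EuclideanSpace ℝ (Fin n)`. -/
local notation "𝔼 " n:arg => EuclideanSpace ℝ (Fin n)

/-- Local notation: `ℍ n` is the closed half space `EuclideanHalfSpace n`. -/
local notation "ℍ " n:arg => EuclideanHalfSpace n

open BoundaryManifold

/-! ### §1 Euclidean preliminaries: flat discs and boxes -/

section Euclid

variable {k : ℕ}

/-- The distance from a vector to its projection `(0, tail w)` on the hyperplane is `|w 0|`.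
[folklore] -/
theorem dist_consCLE_tail (w : 𝔼 (k + 1)) : dist w (consCLE k (tail k w, 0)) = |w 0| := by
  have h : w - consCLE k (tail k w, 0) = consCLE k (0, w 0) := by
    have h1 : consCLE k (tail k w, 0) + consCLE k (0, w 0) = w := by
      rw [← map_add, Prod.mk_add_mk, add_zero, zero_add, consCLE_tail]
    rw [sub_eq_iff_eq_add']; exact h1.symm
  have h2 : ‖consCLE k ((0 : 𝔼 k), w 0)‖ ^ 2 = (w 0) ^ 2 := by
    rw [FlatCollar.norm_sq_consCLE, norm_zero]; ring
  rw [dist_eq_norm, h, ← Real.sqrt_sq (norm_nonneg _), h2, Real.sqrt_sq_eq_abs]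

/-- `‖w‖ ≤ |w 0| + ‖tail w‖`. [folklore] -/
theorem norm_le_abs_add_norm_tail (w : 𝔼 (k + 1)) : ‖w‖ ≤ |w 0| + ‖tail k w‖ := by
  have h := FlatCollar.norm_sq_eq_sq_add w
  have h1 : ‖w‖ ^ 2 ≤ (|w 0| + ‖tail k w‖) ^ 2 := by
    rw [h]; nlinarith [abs_nonneg (w 0), norm_nonneg (tail k w), sq_abs (w 0)]
  exact le_of_pow_le_pow_left₀ two_ne_zero (by positivity) h1

/-- The flat disc `{w 0 = 0, ‖tail w‖ ≤ R}` of the boundary hyperplane is compact (it is the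
image of a closed ball of `ℝᵏ`). [folklore] -/
theorem isCompact_flatDisc (R : ℝ) :
    IsCompact {w : 𝔼 (k + 1) | w 0 = 0 ∧ ‖tail k w‖ ≤ R} := by
  have h : {w : 𝔼 (k + 1) | w 0 = 0 ∧ ‖tail k w‖ ≤ R} =
      (fun u : 𝔼 k => consCLE k (u, 0)) '' closedBall (0 : 𝔼 k) R := by
    ext w
    constructor
    · rintro ⟨h0, hR⟩
      exact ⟨tail k w, by simpa using hR, consCLE_tail_of_eq_zero k h0⟩
    · rintro ⟨u, hu, rfl⟩
      exact ⟨consCLE_apply_zero k (u, 0), by simpa using hu⟩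
  rw [h]
  exact (isCompact_closedBall _ _).image (contDiff_consCLE_zero k).continuous

/-- **An open set containing a flat disc contains a closed box around it.** [folklore] -/
theorem exists_box_subset_of_flatDisc_subset {U : Set (𝔼 (k + 1))} (hU : IsOpen U) {R : ℝ}
    (h : {w : 𝔼 (k + 1) | w 0 = 0 ∧ ‖tail k w‖ ≤ R} ⊆ U) :
    ∃ δ : ℝ, 0 < δ ∧ {w : 𝔼 (k + 1) | |w 0| ≤ δ ∧ ‖tail k w‖ ≤ R} ⊆ U := by
  obtain ⟨δ, hδ, hsub⟩ := (isCompact_flatDisc R).exists_cthickening_subset_open hU h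
  refine ⟨δ, hδ, fun w hw => hsub ?_⟩
  refine Metric.mem_cthickening_of_dist_le w (consCLE k (tail k w, 0)) δ _ ⟨?_, ?_⟩ ?_
  · exact consCLE_apply_zero k _
  · simpa using hw.2
  · rw [dist_consCLE_tail]; exact hw.1

/-- The unit upward normal `e₀ = (1, 0, …, 0)`. [folklore] -/
def upNormal (k : ℕ) : 𝔼 (k + 1) := consCLE k (0, 1)

/-- The height of the upward normal is `1`. [folklore] -/
@[simp] theorem upNormal_apply_zero : upNormal k 0 = 1 := consCLE_apply_zero k _

/-- The upward normal has no tail. [folklore] -/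
@[simp] theorem tail_upNormal : tail k (upNormal k) = 0 := tail_consCLE k _

/-- Decomposition of a vector into its hyperplane part and its normal part. [folklore] -/
theorem consCLE_tail_add_smul_upNormal (v : 𝔼 (k + 1)) :
    consCLE k (tail k v, 0) + v 0 • upNormal k = v := by
  rw [upNormal, ← map_smul, ← map_add, Prod.smul_mk, smul_zero, smul_eq_mul, mul_one,
    Prod.mk_add_mk, add_zero, zero_add, consCLE_tail]

end Euclid

/-! ### §2 Injective local diffeomorphisms of a vector space are partial diffeomorphisms -/

section LocalInverse

variable {E : Type*} [NormedAddCommGroup E] [NormedSpace ℝ E]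

/-- A continuous linear endomorphism of a finite-dimensional space with trivial kernel, as a
continuous linear equivalence. [folklore] -/
def continuousLinearEquivOfInjective [FiniteDimensional ℝ E] (L : E →L[ℝ] E)
    (h : Injective L) : E ≃L[ℝ] E :=
  LinearEquiv.toContinuousLinearEquiv
    (LinearEquiv.ofBijective L.toLinearMap
      ⟨h, LinearMap.surjective_of_injective (f := L.toLinearMap) h⟩)

/-- The equivalence acts as the given map. [folklore] -/
@[simp] theorem coe_continuousLinearEquivOfInjective [FiniteDimensional ℝ E] (L : E →L[ℝ] E)
    (h : Injective L) : (continuousLinearEquivOfInjective L h : E →L[ℝ] E) = L := by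
  ext x; rfl

/-- **An injective `C^∞` map with invertible derivatives on an open set is a diffeomorphism onto
an open set**: it is the underlying map of an open partial homeomorphism with source the given
open set, `C^∞` with `C^∞` inverse (inverse function theorem at every point, glued along the
injectivity). [folklore] -/
theorem exists_openPartialHomeomorph_of_injOn [CompleteSpace E] {φ : E → E} {V : Set E}
    (hV : IsOpen V)
    (hφ : ContDiffOn ℝ ∞ φ V) (hinj : InjOn φ V)
    (hder : ∀ z ∈ V, ∃ e : E ≃L[ℝ] E, HasFDerivAt φ (e : E →L[ℝ] E) z) :
    ∃ Φ : OpenPartialHomeomorph E E, Φ.source = V ∧ (∀ z, Φ z = φ z) ∧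
      ContDiffOn ℝ ∞ Φ Φ.source ∧ ContDiffOn ℝ ∞ Φ.symm Φ.target := by
  -- local inverses
  have hloc : ∀ z ∈ V, ∃ Ψ : OpenPartialHomeomorph E E, z ∈ Ψ.source ∧ Ψ.source ⊆ V ∧
      (∀ y, Ψ y = φ y) ∧ ContDiffOn ℝ ∞ Ψ.symm Ψ.target := fun z hz => by
    obtain ⟨e, he⟩ := hder z hz
    obtain ⟨Ψ, hzΨ, hΨV, hΨφ, -, hΨsymm⟩ := exists_openPartialHomeomorph_of_hasFDerivAt hV hz hφ e he
    exact ⟨Ψ, hzΨ, hΨV, hΨφ, hΨsymm⟩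
  set e := hinj.toPartialEquiv φ V with he_def
  have he_coe : ∀ z, e z = φ z := fun z => rfl
  have he_src : e.source = V := rfl
  have he_tgt : e.target = φ '' V := rfl
  -- around the image of a point, the inverse is the local inverse
  have key : ∀ z ∈ V, ∃ Ψ : OpenPartialHomeomorph E E, φ z ∈ Ψ.target ∧ Ψ.target ⊆ φ '' V ∧
      (∀ y ∈ Ψ.target, e.symm y = Ψ.symm y) ∧ ContDiffOn ℝ ∞ Ψ.symm Ψ.target := by
    intro z hz
    obtain ⟨Ψ, hzΨ, hΨV, hΨφ, hΨsymm⟩ := hloc z hz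
    have hφz : φ z ∈ Ψ.target := by rw [← hΨφ]; exact Ψ.map_source hzΨ
    have htV : Ψ.target ⊆ φ '' V := fun y hy =>
      ⟨Ψ.symm y, hΨV (Ψ.map_target hy), by rw [← hΨφ]; exact Ψ.right_inv hy⟩
    refine ⟨Ψ, hφz, htV, fun y hy => ?_, hΨsymm⟩
    have hy' : y ∈ e.target := htV hy
    have h1 : e.symm y ∈ V := e.map_target hy'
    have h2 : φ (e.symm y) = y := e.right_inv hy'
    have h3 : Ψ.symm y ∈ V := hΨV (Ψ.map_target hy)
    have h4 : φ (Ψ.symm y) = y := by rw [← hΨφ]; exact Ψ.right_inv hy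
    exact hinj h1 h3 (h2.trans h4.symm)
  have hopen : IsOpen (φ '' V) := by
    refine isOpen_iff_mem_nhds.2 ?_
    rintro _ ⟨z, hz, rfl⟩
    obtain ⟨Ψ, hφz, htV, -, -⟩ := key z hz
    exact mem_of_superset (Ψ.open_target.mem_nhds hφz) htV
  have hsmooth : ∀ y ∈ φ '' V, ContDiffAt ℝ ∞ e.symm y := by
    rintro _ ⟨z, hz, rfl⟩
    obtain ⟨Ψ, hφz, -, heq, hΨsymm⟩ := key z hz
    have hev : e.symm =ᶠ[𝓝 (φ z)] Ψ.symm :=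
      Filter.eventuallyEq_of_mem (Ψ.open_target.mem_nhds hφz) heq
    exact (hΨsymm.contDiffAt (Ψ.open_target.mem_nhds hφz)).congr_of_eventuallyEq hev
  set Φ : OpenPartialHomeomorph E E :=
    { toPartialEquiv := e
      open_source := hV
      open_target := hopen
      continuousOn_toFun := hφ.continuousOn
      continuousOn_invFun := fun y hy => (hsmooth y hy).continuousAt.continuousWithinAt }
  exact ⟨Φ, rfl, fun z => rfl, hφ, fun y hy => (hsmooth y hy).contDiffWithinAt⟩

end LocalInverse

/-! ### §3 The tangential cut-off: from a two-sided flat collar germ to a diffeomorphism -/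

section CutOff

variable {k : ℕ}

/-- The derivative of a germ fixing the hyperplane pointwise is the identity on the hyperplane
directions. [folklore] -/
theorem fderiv_germ_apply_of_apply_zero (M₀ : OpenPartialHomeomorph (𝔼 (k + 1)) (𝔼 (k + 1)))
    (hM₀ : ContDiffOn ℝ ∞ M₀ M₀.source) (hfix : ∀ w ∈ M₀.source, w 0 = 0 → M₀ w = w)
    {p : 𝔼 (k + 1)} (hp : p ∈ M₀.source) (hp0 : p 0 = 0) {v : 𝔼 (k + 1)} (hv : v 0 = 0) :
    fderiv ℝ M₀ p v = v := by
  have hd : HasFDerivAt M₀ (fderiv ℝ M₀ p) p :=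
    ((hM₀.contDiffAt (M₀.open_source.mem_nhds hp)).differentiableAt (by simp)).hasFDerivAt
  have hγ : HasDerivAt (fun t : ℝ => p + t • v) v 0 := by
    simpa using ((hasDerivAt_id (0 : ℝ)).smul_const v).const_add p
  have h1 : HasDerivAt (fun t : ℝ => M₀ (p + t • v)) (fderiv ℝ M₀ p v) 0 :=
    hd.comp_hasDerivAt_of_eq (0 : ℝ) hγ (by simp)
  have h2 : HasDerivAt (fun t : ℝ => M₀ (p + t • v)) v 0 := by
    refine hγ.congr_of_eventuallyEq ?_
    have hcont : Continuous fun t : ℝ => p + t • v := by fun_prop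
    have hmem : ∀ᶠ t in 𝓝 (0 : ℝ), p + t • v ∈ M₀.source :=
      hcont.continuousAt.preimage_mem_nhds (by simpa using M₀.open_source.mem_nhds hp)
    filter_upwards [hmem] with t ht
    exact hfix _ ht (by simp [hp0, hv])
  exact h1.unique h2

/-- The derivative of a germ with `C^∞` inverse is invertible. [folklore] -/
theorem exists_equiv_eq_fderiv_germ (M₀ : OpenPartialHomeomorph (𝔼 (k + 1)) (𝔼 (k + 1)))
    (hM₀ : ContDiffOn ℝ ∞ M₀ M₀.source) (hM₀' : ContDiffOn ℝ ∞ M₀.symm M₀.target)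
    {p : 𝔼 (k + 1)} (hp : p ∈ M₀.source) :
    ∃ e : 𝔼 (k + 1) ≃L[ℝ] 𝔼 (k + 1), (e : 𝔼 (k + 1) →L[ℝ] 𝔼 (k + 1)) = fderiv ℝ M₀ p := by
  have hd : HasFDerivAt M₀ (fderiv ℝ M₀ p) p :=
    ((hM₀.contDiffAt (M₀.open_source.mem_nhds hp)).differentiableAt (by simp)).hasFDerivAt
  have hd' : HasFDerivAt M₀.symm (fderiv ℝ M₀.symm (M₀ p)) (M₀ p) :=
    ((hM₀'.contDiffAt (M₀.open_target.mem_nhds (M₀.map_source hp))).differentiableAt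
      (by simp)).hasFDerivAt
  have hcomp := comp_fderiv_eq_id_of_leftInvOn hd hd' uniqueDiffWithinAt_univ (mem_univ p) (by
    rw [nhdsWithin_univ]
    filter_upwards [M₀.open_source.mem_nhds hp] with z hz using M₀.left_inv hz)
  exact ⟨linearEquivOfLeftInverse _ _ hcomp, coe_linearEquivOfLeftInverse _ _ hcomp⟩

/-- `‖upNormal‖ = 1`. [folklore] -/
@[simp] theorem norm_upNormal : ‖upNormal k‖ = 1 := by
  have h : ‖upNormal k‖ ^ 2 = 1 := by
    rw [upNormal, FlatCollar.norm_sq_consCLE, norm_zero]; ring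
  have h0 : 0 ≤ ‖upNormal k‖ := norm_nonneg _
  nlinarith [h, h0]

/-- **The normal derivative of a flat collar germ is positive**: if the germ fixes the hyperplane
pointwise and carries the upper side to the upper side, then `(D M₀(p) e₀) 0 > 0` at hyperplane
points `p` (nonnegative by the one-sided sign condition — Fermat's theorem on the half space —
and nonzero since `D M₀(p)` is invertible and the identity on the hyperplane). [folklore] -/
theorem fderiv_germ_upNormal_pos (M₀ : OpenPartialHomeomorph (𝔼 (k + 1)) (𝔼 (k + 1)))
    (hM₀ : ContDiffOn ℝ ∞ M₀ M₀.source) (hM₀' : ContDiffOn ℝ ∞ M₀.symm M₀.target)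
    (hfix : ∀ w ∈ M₀.source, w 0 = 0 → M₀ w = w)
    (hpos : ∀ w ∈ M₀.source, 0 < w 0 → 0 < M₀ w 0)
    {p : 𝔼 (k + 1)} (hp : p ∈ M₀.source) (hp0 : p 0 = 0) :
    0 < fderiv ℝ M₀ p (upNormal k) 0 := by
  set D := fderiv ℝ M₀ p with hD
  have hd : HasFDerivAt M₀ D p :=
    ((hM₀.contDiffAt (M₀.open_source.mem_nhds hp)).differentiableAt (by simp)).hasFDerivAt
  -- nonnegativity: `w ↦ (M₀ w) 0` has a local minimum at `p` on the closed half space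
  have hnn : 0 ≤ D (upNormal k) 0 := by
    set f : 𝔼 (k + 1) → ℝ := ⇑(EuclideanSpace.proj (0 : Fin (k + 1))) ∘ (M₀ : 𝔼 (k + 1) → 𝔼 (k + 1))
      with hf_def
    have hf_apply : ∀ w, f w = M₀ w 0 := fun w => rfl
    have hf : HasFDerivAt f ((EuclideanSpace.proj (0 : Fin (k + 1))).comp D) p :=
      (EuclideanSpace.proj (0 : Fin (k + 1))).hasFDerivAt.comp p hd
    set s : Set (𝔼 (k + 1)) := {w | 0 ≤ w 0} ∩ M₀.source with hs_def
    have hmin : IsLocalMinOn f s p := by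
      refine Filter.eventually_of_mem self_mem_nhdsWithin fun w hw => ?_
      have hfp : f p = 0 := by rw [hf_apply, hfix p hp hp0, hp0]
      show f p ≤ f w
      rw [hfp, hf_apply]
      rcases (show 0 ≤ w 0 from hw.1).lt_or_eq with h | h
      · exact (hpos w hw.2 h).le
      · rw [hfix w hw.2 h.symm, ← h]
    -- a small upward segment inside `s`
    obtain ⟨r, hr, hball⟩ := Metric.isOpen_iff.1 M₀.open_source p hp
    have hy : (r / 2) • upNormal k ∈ posTangentConeAt s p := by
      apply mem_posTangentConeAt_of_segment_subset
      rw [segment_eq_image']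
      rintro _ ⟨θ, ⟨hθ0, hθ1⟩, rfl⟩
      simp only [add_sub_cancel_left]
      refine ⟨?_, hball ?_⟩
      · show 0 ≤ (p + θ • (r / 2) • upNormal k) 0
        simp [hp0]; positivity
      · rw [mem_ball, dist_eq_norm, add_sub_cancel_left, norm_smul, norm_smul, norm_upNormal,
          Real.norm_eq_abs, Real.norm_eq_abs, abs_of_nonneg hθ0, abs_of_pos (by positivity)]
        nlinarith
    have h := hmin.hasFDerivWithinAt_nonneg hf.hasFDerivWithinAt hy
    simp only [ContinuousLinearMap.comp_apply, map_smul, smul_eq_mul] at h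
    have h' : 0 ≤ r / 2 * D (upNormal k) 0 := by simpa using h
    exact (mul_nonneg_iff_of_pos_left (by positivity)).1 h'
  -- nonvanishing
  have hne : D (upNormal k) 0 ≠ 0 := by
    intro h0
    obtain ⟨e, he⟩ := exists_equiv_eq_fderiv_germ M₀ hM₀ hM₀' hp
    have h1 : D (D (upNormal k)) = D (upNormal k) :=
      fderiv_germ_apply_of_apply_zero M₀ hM₀ hfix hp hp0 h0
    have hDe : ∀ v, D v = e v := fun v => by
      simp only [hD, ← he, ContinuousLinearEquiv.coe_coe]
    have h3 : e (D (upNormal k)) = e (upNormal k) := by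
      rw [← hDe (D (upNormal k)), h1, hDe]
    have h2 : D (upNormal k) = upNormal k := e.injective h3
    have : upNormal k 0 = 0 := by rw [← h2]; exact h0
    simp at this
  exact lt_of_le_of_ne hnn (Ne.symm hne)

/-- Derivative of the cut-off collar `w ↦ w + c w • (f w - w)` at a fixed point of `f`.
[folklore] -/
theorem hasFDerivAt_cutoffCollar {E : Type*} [NormedAddCommGroup E] [NormedSpace ℝ E]
    {f : E → E} {c : E → ℝ} {p : E} {D : E →L[ℝ] E} {c' : E →L[ℝ] ℝ}
    (hf : HasFDerivAt f D p) (hc : HasFDerivAt c c' p) (hfp : f p = p) :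
    HasFDerivAt (fun w => w + c w • (f w - w))
      (ContinuousLinearMap.id ℝ E + c p • (D - ContinuousLinearMap.id ℝ E)) p := by
  have h1 : HasFDerivAt (fun w => f w - w) (D - ContinuousLinearMap.id ℝ E) p :=
    hf.sub (hasFDerivAt_id p)
  have h2 := hc.smul h1
  have h0 : c'.smulRight (f p - p) = 0 := by ext; simp [hfp]
  rw [h0, add_zero] at h2
  exact (hasFDerivAt_id p).add h2

/-- The convex combination `id + c (D - id)`, `0 ≤ c ≤ 1`, of the identity with a linear map
`D` which is the identity on the hyperplane and has positive normal-normal entry is injective.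
[folklore] -/
theorem injective_id_add_smul_sub {D : 𝔼 (k + 1) →L[ℝ] 𝔼 (k + 1)}
    (hD : ∀ v : 𝔼 (k + 1), v 0 = 0 → D v = v) (hDpos : 0 < D (upNormal k) 0)
    {c : ℝ} (hc0 : 0 ≤ c) (hc1 : c ≤ 1) :
    Injective (ContinuousLinearMap.id ℝ (𝔼 (k + 1)) +
      c • (D - ContinuousLinearMap.id ℝ (𝔼 (k + 1)))) := by
  set L := ContinuousLinearMap.id ℝ (𝔼 (k + 1)) + c • (D - ContinuousLinearMap.id ℝ (𝔼 (k + 1)))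
    with hL_def
  have hL : ∀ v, L v = v + c • (D v - v) := fun v => rfl
  have hLH : ∀ v : 𝔼 (k + 1), v 0 = 0 → L v = v := fun v hv => by
    rw [hL, hD v hv, sub_self, smul_zero, add_zero]
  have hLe : L (upNormal k) 0 = (1 - c) + c * D (upNormal k) 0 := by
    rw [hL]
    simp only [PiLp.add_apply, PiLp.smul_apply, PiLp.sub_apply, smul_eq_mul, upNormal_apply_zero]
    ring
  have hLe_pos : 0 < L (upNormal k) 0 := by
    rw [hLe]
    rcases hc1.lt_or_eq with h | h
    · nlinarith [mul_nonneg hc0 hDpos.le]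
    · rw [h]; linarith
  refine (injective_iff_map_eq_zero L).2 fun v hv => ?_
  have hdec := consCLE_tail_add_smul_upNormal v
  set vH := consCLE k (tail k v, 0) with hvH_def
  have hvH0 : vH 0 = 0 := consCLE_apply_zero k _
  have hLv : L v = vH + v 0 • L (upNormal k) := by
    conv_lhs => rw [← hdec]
    rw [map_add, map_smul, hLH vH hvH0]
  have h0 : v 0 = 0 := by
    have h := congrArg (fun w : 𝔼 (k + 1) => w 0) hLv
    simp only [hv, PiLp.zero_apply, PiLp.add_apply, PiLp.smul_apply, smul_eq_mul, hvH0,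
      zero_add] at h
    rcases mul_eq_zero.1 h.symm with h' | h'
    · exact h'
    · exact absurd h' hLe_pos.ne'
  rw [hLH v h0] at hv
  exact hv

/-- **From a two-sided flat collar germ to a compactly supported diffeomorphism of the half
space** (uniqueness of collars, relative and compactly supported form, for the comparison germ of
two collars of a seam). Let `M₀` be a `C^∞` diffeomorphism between open subsets of `ℝᵏ⁺¹` (an
open partial homeomorphism, `C^∞` with `C^∞` inverse) whose source contains the flat disc
`{w 0 = 0, ‖tail w‖ ≤ R₀ + 2}` of the boundary hyperplane, which fixes the hyperplane points of
its source and carries source points of positive height to points of positive height. Then there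
is a diffeomorphism `Θ` of the closed half space `ℝᵏ⁺¹₊` (model `𝓡∂ (k + 1)`) which agrees with
`M₀` on the slab piece `{x 0 ≤ η₁, ‖tail x‖ ≤ R₀}` for some `η₁ > 0`, is the identity outside a
bounded set and fixes the hyperplane pointwise. Proof: cut `M₀` off tangentially,
`μ = id + χ(tail) (M₀ - id)` — still a flat collar since `(μ w) 0` is a convex combination of
`w 0` and `(M₀ w) 0` and `Dμ = (1 - χ) id + χ DM₀` is invertible along the hyperplane
(`fderiv_germ_upNormal_pos`) —, invert it near a large flat disc
(`exists_isOpen_injOn_of_isCompact`, `exists_openPartialHomeomorph_of_injOn`) to obtain a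
supported flat collar (`FlatCollar.IsSupportedFlatCollar`), and apply the tree's
`FlatCollar.IsSupportedFlatCollar.exists_diffeomorph` (transplant to an inner collar of the unit
sphere and splice). Hirsch, *Differential Topology* (1976), Ch. 8, Thm. 1.8 and proof of Thm. 1.9;
Munkres, *Elementary Differential Topology* (1966), §6.
[cite: HirschDT1976, Ch. 8 §1, Thm. 1.8 and proof of Thm. 1.9, pp. 181–182] -/
theorem exists_halfSpaceDiffeomorph_of_flatCollarGerm
    (M₀ : OpenPartialHomeomorph (𝔼 (k + 1)) (𝔼 (k + 1)))
    (hM₀ : ContDiffOn ℝ ∞ M₀ M₀.source) (hM₀' : ContDiffOn ℝ ∞ M₀.symm M₀.target)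
    {R₀ : ℝ} (hR₀ : 0 < R₀)
    (hdisc : {w : 𝔼 (k + 1) | w 0 = 0 ∧ ‖tail k w‖ ≤ R₀ + 2} ⊆ M₀.source)
    (hfix : ∀ w ∈ M₀.source, w 0 = 0 → M₀ w = w)
    (hpos : ∀ w ∈ M₀.source, 0 < w 0 → 0 < M₀ w 0) :
    ∃ (Θ : (ℍ (k + 1)) ≃ₘ⟮𝓡∂ (k + 1), 𝓡∂ (k + 1)⟯ (ℍ (k + 1))) (η₁ ρ : ℝ), 0 < η₁ ∧
      (∀ x : ℍ (k + 1), x.val 0 ≤ η₁ → ‖tail k x.val‖ ≤ R₀ →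
          x.val ∈ M₀.source ∧ (Θ x).val = M₀ x.val) ∧
      (∀ x : ℍ (k + 1), ρ ≤ ‖x.val‖ → Θ x = x) ∧
      (∀ x : ℍ (k + 1), x.val 0 = 0 → Θ x = x) := by
  -- Step 1: a closed box inside the source
  obtain ⟨δ₀, hδ₀, hbox⟩ := exists_box_subset_of_flatDisc_subset M₀.open_source hdisc
  have hsrc : ∀ w : 𝔼 (k + 1), |w 0| ≤ δ₀ → ‖tail k w‖ ≤ R₀ + 2 → w ∈ M₀.source :=
    fun w h1 h2 => hbox ⟨h1, h2⟩
  -- Step 2: the tangential cut-off function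
  let χ : ContDiffBump (0 : 𝔼 k) := ⟨R₀ + 1 / 4, R₀ + 1 / 2, by linarith, by linarith⟩
  set c : 𝔼 (k + 1) → ℝ := fun w => χ (tail k w) with hc_def
  have hc_smooth : ContDiff ℝ ∞ c := χ.contDiff.comp (contDiff_tail k)
  have hc_one : ∀ w, ‖tail k w‖ ≤ R₀ + 1 / 4 → c w = 1 := fun w hw =>
    χ.one_of_mem_closedBall (by rw [mem_closedBall, dist_zero_right]; exact hw)
  have hc_zero : ∀ w, R₀ + 1 / 2 ≤ ‖tail k w‖ → c w = 0 := fun w hw =>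
    χ.zero_of_le_dist (by rw [dist_zero_right]; exact hw)
  have hc_nn : ∀ w, 0 ≤ c w := fun w => χ.nonneg
  have hc_le : ∀ w, c w ≤ 1 := fun w => χ.le_one
  -- Step 3: the cut-off collar `μ`
  set μ : 𝔼 (k + 1) → 𝔼 (k + 1) := fun w => w + c w • (M₀ w - w) with hμ_def
  have hμ_far : ∀ w, R₀ + 1 / 2 ≤ ‖tail k w‖ → μ w = w := fun w hw => by
    simp [hμ_def, hc_zero w hw]
  have hμ_near : ∀ w, ‖tail k w‖ ≤ R₀ + 1 / 4 → μ w = M₀ w := fun w hw => by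
    simp [hμ_def, hc_one w hw]
  have hμ_fix : ∀ w, w 0 = 0 → μ w = w := by
    intro w hw
    by_cases h : ‖tail k w‖ ≤ R₀ + 2
    · have hws := hsrc w (by rw [hw, abs_zero]; exact hδ₀.le) h
      simp [hμ_def, hfix w hws hw]
    · exact hμ_far w (by linarith [not_le.1 h])
  have hμ_zero : ∀ w, μ w 0 = (1 - c w) * w 0 + c w * M₀ w 0 := fun w => by
    simp only [hμ_def, PiLp.add_apply, PiLp.smul_apply, PiLp.sub_apply, smul_eq_mul]; ring
  have hμ_pos : ∀ w, 0 < w 0 → w 0 ≤ δ₀ → 0 < μ w 0 := by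
    intro w hw0 hwδ
    by_cases h : ‖tail k w‖ ≤ R₀ + 2
    · have hws := hsrc w (by rw [abs_of_pos hw0]; exact hwδ) h
      have hp := hpos w hws hw0
      rw [hμ_zero]
      rcases (hc_le w).lt_or_eq with h1 | h1
      · nlinarith [hc_nn w]
      · rw [h1]; linarith
    · rw [hμ_far w (by linarith [not_le.1 h])]; exact hw0
  -- smoothness on the open slab `S`
  set S : Set (𝔼 (k + 1)) := {w | |w 0| < δ₀} with hS_def
  have h0cont : Continuous fun w : 𝔼 (k + 1) => w 0 := FlatCollar.contDiff_apply_zero.continuous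
  have hSo : IsOpen S := isOpen_lt (continuous_abs.comp h0cont) continuous_const
  have hfarO : IsOpen {w : 𝔼 (k + 1) | R₀ + 1 / 2 < ‖tail k w‖} :=
    isOpen_lt continuous_const (continuous_norm.comp (continuous_tail k))
  have hμ_id_near : ∀ w : 𝔼 (k + 1), R₀ + 1 / 2 < ‖tail k w‖ → μ =ᶠ[𝓝 w] id := fun w hw =>
    Filter.eventuallyEq_of_mem (hfarO.mem_nhds hw) fun z hz => hμ_far z (le_of_lt hz)
  have hμ_smoothAt : ∀ w ∈ S, ContDiffAt ℝ ∞ μ w := by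
    intro w hw
    by_cases h : ‖tail k w‖ < R₀ + 2
    · have hO : IsOpen {w : 𝔼 (k + 1) | |w 0| < δ₀ ∧ ‖tail k w‖ < R₀ + 2} :=
        hSo.inter (isOpen_lt (continuous_norm.comp (continuous_tail k)) continuous_const)
      have hOs : {w : 𝔼 (k + 1) | |w 0| < δ₀ ∧ ‖tail k w‖ < R₀ + 2} ⊆ M₀.source :=
        fun w hw => hsrc w hw.1.le hw.2.le
      have hM₀w : ContDiffAt ℝ ∞ M₀ w :=
        hM₀.contDiffAt (Filter.mem_of_superset (hO.mem_nhds ⟨hw, h⟩) hOs)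
      exact contDiffAt_id.add (hc_smooth.contDiffAt.smul (hM₀w.sub contDiffAt_id))
    · exact contDiffAt_id.congr_of_eventuallyEq (hμ_id_near w (by linarith [not_lt.1 h]))
  have hμ_smooth : ContDiffOn ℝ ∞ μ S := fun w hw => (hμ_smoothAt w hw).contDiffWithinAt
  have hμ_cont : ContinuousOn μ S := hμ_smooth.continuousOn
  -- Step 4: invertible derivative at the hyperplane points
  have hder : ∀ p : 𝔼 (k + 1), p 0 = 0 →
      ∃ e : 𝔼 (k + 1) ≃L[ℝ] 𝔼 (k + 1), HasFDerivAt μ (e : 𝔼 (k + 1) →L[ℝ] 𝔼 (k + 1)) p := by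
    intro p hp0
    by_cases h : ‖tail k p‖ ≤ R₀ + 1
    · have hps : p ∈ M₀.source := hsrc p (by rw [hp0, abs_zero]; exact hδ₀.le) (by linarith)
      have hd : HasFDerivAt M₀ (fderiv ℝ M₀ p) p :=
        ((hM₀.contDiffAt (M₀.open_source.mem_nhds hps)).differentiableAt (by simp)).hasFDerivAt
      have hcd : HasFDerivAt c (fderiv ℝ c p) p :=
        (hc_smooth.differentiable (by simp) p).hasFDerivAt
      have hμd := hasFDerivAt_cutoffCollar hd hcd (hfix p hps hp0)
      have hinj := injective_id_add_smul_sub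
        (fun v hv => fderiv_germ_apply_of_apply_zero M₀ hM₀ hfix hps hp0 hv)
        (fderiv_germ_upNormal_pos M₀ hM₀ hM₀' hfix hpos hps hp0) (hc_nn p) (hc_le p)
      exact ⟨continuousLinearEquivOfInjective _ hinj, by
        rw [coe_continuousLinearEquivOfInjective]; exact hμd⟩
    · refine ⟨ContinuousLinearEquiv.refl ℝ _, ?_⟩
      rw [ContinuousLinearEquiv.coe_refl]
      exact (hasFDerivAt_id p).congr_of_eventuallyEq (hμ_id_near p (by linarith [not_le.1 h]))
  -- Step 5: a tangential bound `R₂` on the compact box `B₁`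
  set δ := δ₀ / 2 with hδ_def
  have hδ : 0 < δ := by positivity
  have hδlt : δ < δ₀ := by rw [hδ_def]; linarith
  set B₁ : Set (𝔼 (k + 1)) := {w | |w 0| ≤ δ ∧ ‖tail k w‖ ≤ R₀ + 1} with hB₁_def
  have hB₁c : IsCompact B₁ := by
    refine Metric.isCompact_of_isClosed_isBounded ?_ ?_
    · exact (isClosed_le (continuous_abs.comp h0cont) continuous_const).inter
        (isClosed_le (continuous_norm.comp (continuous_tail k)) continuous_const)
    · refine (isBounded_closedBall (x := (0 : 𝔼 (k + 1))) (r := δ + (R₀ + 1))).subset ?_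
      intro w hw
      rw [mem_closedBall_zero_iff]
      linarith [norm_le_abs_add_norm_tail w, hw.1, hw.2]
  have hB₁S : B₁ ⊆ S := fun w hw => lt_of_le_of_lt hw.1 hδlt
  obtain ⟨R₂, hR₂lt, hR₂⟩ := ((hB₁c.image_of_continuousOn (hμ_cont.mono hB₁S)).isBounded).subset_ball_lt
    (R₀ + 1) (0 : 𝔼 (k + 1))
  -- Step 6: injectivity and invertibility near a large flat disc
  set D₃ : Set (𝔼 (k + 1)) := {w | w 0 = 0 ∧ ‖tail k w‖ ≤ R₂ + 2} with hD₃_def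
  have hD₃S : D₃ ⊆ S := fun w hw => by
    show |w 0| < δ₀
    rw [hw.1, abs_zero]; exact hδ₀
  obtain ⟨V₀, hV₀o, hD₃V₀, hinjV₀⟩ := exists_isOpen_injOn_of_isCompact (isCompact_flatDisc (R₂ + 2))
    (fun w hw => (hμ_smoothAt w (hD₃S hw)).continuousAt)
    (fun w hw z hz h => by rwa [hμ_fix w hw.1, hμ_fix z hz.1] at h)
    (fun w hw => by
      obtain ⟨e, he⟩ := hder w hw.1
      obtain ⟨Ψ, hwΨ, -, hΨμ, -, -⟩ :=
        exists_openPartialHomeomorph_of_hasFDerivAt hSo (hD₃S hw) hμ_smooth e he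
      exact ⟨Ψ.source, Ψ.open_source.mem_nhds hwΨ, fun a ha b hb hab =>
        Ψ.injOn ha hb (by rw [hΨμ, hΨμ]; exact hab)⟩)
  set V₁ : Set (𝔼 (k + 1)) := S ∩ (fderiv ℝ μ) ⁻¹'
    range ((↑) : (𝔼 (k + 1) ≃L[ℝ] 𝔼 (k + 1)) → 𝔼 (k + 1) →L[ℝ] 𝔼 (k + 1)) with hV₁_def
  have hV₁o : IsOpen V₁ :=
    (hμ_smooth.continuousOn_fderiv_of_isOpen hSo (by simp)).isOpen_inter_preimage hSo
      ContinuousLinearEquiv.isOpen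
  have hD₃V₁ : D₃ ⊆ V₁ := fun w hw => by
    obtain ⟨e, he⟩ := hder w hw.1
    exact ⟨hD₃S hw, ⟨e, he.fderiv.symm⟩⟩
  set V : Set (𝔼 (k + 1)) := V₀ ∩ V₁ with hV_def
  have hVo : IsOpen V := hV₀o.inter hV₁o
  have hVS : V ⊆ S := fun w hw => hw.2.1
  have hderV : ∀ z ∈ V, ∃ e : 𝔼 (k + 1) ≃L[ℝ] 𝔼 (k + 1),
      HasFDerivAt μ (e : 𝔼 (k + 1) →L[ℝ] 𝔼 (k + 1)) z := by
    rintro z ⟨-, hzS, ⟨e, he⟩⟩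
    refine ⟨e, ?_⟩
    rw [he]
    exact ((hμ_smoothAt z hzS).differentiableAt (by simp)).hasFDerivAt
  obtain ⟨M, hMsrc, hMμ, -, hMs'⟩ := exists_openPartialHomeomorph_of_injOn hVo (hμ_smooth.mono hVS)
    (hinjV₀.mono inter_subset_left) hderV
  -- Step 7: the boxes in the source and the target of `M`
  have hD₂V : {w : 𝔼 (k + 1) | w 0 = 0 ∧ ‖tail k w‖ ≤ R₂ + 1} ⊆ M.source := by
    rw [hMsrc]
    exact fun w hw => ⟨hD₃V₀ ⟨hw.1, by linarith [hw.2]⟩, hD₃V₁ ⟨hw.1, by linarith [hw.2]⟩⟩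
  obtain ⟨ηs, hηs, hboxs⟩ := exists_box_subset_of_flatDisc_subset M.open_source hD₂V
  have hD₂T : {w : 𝔼 (k + 1) | w 0 = 0 ∧ ‖tail k w‖ ≤ R₂ + 1} ⊆ M.target := by
    intro w hw
    have hws : w ∈ M.source := hD₂V hw
    have hMw : M w = w := by rw [hMμ]; exact hμ_fix w hw.1
    rw [← hMw]; exact M.map_source hws
  obtain ⟨ηt, hηt, hboxt⟩ := exists_box_subset_of_flatDisc_subset M.open_target hD₂T
  set η := min δ (min ηs ηt) with hη_def
  have hη : 0 < η := lt_min hδ (lt_min hηs hηt)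
  have hηδ : η ≤ δ := min_le_left _ _
  have hηs' : η ≤ ηs := (min_le_right _ _).trans (min_le_left _ _)
  have hηt' : η ≤ ηt := (min_le_right _ _).trans (min_le_right _ _)
  -- Step 8: `μ` is a supported flat collar
  have hcollar : FlatCollar.IsSupportedFlatCollar η (R₀ + 1) R₂ μ M :=
    { η_pos := hη
      R₁_pos := by linarith
      R₁_le := hR₂lt.le
      contDiffOn := hμ_smooth.mono fun w hw => by
        show |w 0| < δ₀
        rw [abs_of_nonneg hw.1]; linarith [hw.2]
      eq_self_of_eq_zero := hμ_fix
      apply_zero_pos := fun w hw0 hwη => hμ_pos w hw0 (by linarith)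
      eq_self_of_le_norm := fun w _ _ hw => hμ_far w (by linarith)
      norm_tail_lt := fun w hw0 hwη hw1 => by
        have hwB : w ∈ B₁ := ⟨by rw [abs_of_nonneg hw0]; linarith, hw1.le⟩
        have hμw : μ w ∈ ball (0 : 𝔼 (k + 1)) R₂ := hR₂ ⟨w, hwB, rfl⟩
        rw [mem_ball_zero_iff] at hμw
        exact (FlatCollar.norm_tail_le _).trans_lt hμw
      box_subset_source := fun w hw => hboxs ⟨by linarith [hw.1.le], hw.2.le⟩
      box_subset_target := fun w hw => hboxt ⟨by linarith [hw.1.le], hw.2.le⟩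
      eqOn_source := fun w _ _ _ => hMμ w
      eq_self_source := fun w _ hw => by rw [hMμ]; exact hμ_far w (by linarith)
      contDiffOn_symm := hMs' }
  -- Step 9: the diffeomorphism
  obtain ⟨Θ, η₁, η₂, hη₁, -, hΘμ, hΘtop, hΘfar, hΘfix⟩ := hcollar.exists_diffeomorph
  refine ⟨Θ, min η₁ δ, η₂ + (R₀ + 1), lt_min hη₁ hδ, fun x hx hxR => ?_, fun x hx => ?_, hΘfix⟩
  · have hx1 : x.val 0 ≤ η₁ := hx.trans (min_le_left _ _)
    have hx2 : x.val 0 ≤ δ := hx.trans (min_le_right _ _)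
    have hxs : x.val ∈ M₀.source :=
      hsrc x.val (by rw [abs_of_nonneg x.2]; linarith) (by linarith)
    exact ⟨hxs, by rw [hΘμ x hx1]; exact hμ_near x.val (by linarith)⟩
  · by_cases h1 : η₂ ≤ x.val 0
    · exact hΘtop x h1
    · apply hΘfar x
      by_contra h2
      have h := norm_le_abs_add_norm_tail x.val
      rw [abs_of_nonneg x.2] at h
      linarith [not_le.1 h1, not_le.1 h2]

end CutOff

/-! ### §4 Transport of a compactly supported self-map along an open embedding -/

section EmbTransport

variable {EN HN EM HM : Type*} [NormedAddCommGroup EN] [NormedSpace ℝ EN] [TopologicalSpace HN]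
  [NormedAddCommGroup EM] [NormedSpace ℝ EM] [TopologicalSpace HM]
  {J : ModelWithCorners ℝ EN HN} {I : ModelWithCorners ℝ EM HM}
  {N M : Type*} [TopologicalSpace N] [ChartedSpace HN N] [TopologicalSpace M] [ChartedSpace HM M]

open Classical in
/-- The transport of a self-map `s` of `N` along an open partial homeomorphism `Φ : N ⇀ M` with
full source (an open embedding `N ↪ M`): `Φ ∘ s ∘ Φ⁻¹` on the image, the identity elsewhere
(cf. the tree's `chartTransport`, the case of a chart onto a vector space). [folklore] -/
def embTransport (Φ : OpenPartialHomeomorph N M) (s : N → N) (x : M) : M :=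
  if x ∈ Φ.target then Φ (s (Φ.symm x)) else x

variable {Φ : OpenPartialHomeomorph N M}

/-- On the image the transport is `Φ ∘ s ∘ Φ⁻¹`. [folklore] -/
theorem embTransport_of_mem (s : N → N) {x : M} (hx : x ∈ Φ.target) :
    embTransport Φ s x = Φ (s (Φ.symm x)) := by
  simp [embTransport, hx]

/-- Off the image the transport is the identity. [folklore] -/
theorem embTransport_of_not_mem (s : N → N) {x : M} (hx : x ∉ Φ.target) :
    embTransport Φ s x = x := by
  simp [embTransport, hx]

/-- The defining relation `H ∘ Φ = Φ ∘ s` of the transport `H`. [folklore] -/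
theorem embTransport_apply_coe (hΦ : Φ.source = univ) (s : N → N) (y : N) :
    embTransport Φ s (Φ y) = Φ (s y) := by
  have hy : y ∈ Φ.source := hΦ ▸ mem_univ y
  rw [embTransport_of_mem s (Φ.map_source hy), Φ.left_inv hy]

/-- Off the image of the support the transport is the identity. [folklore] -/
theorem embTransport_eq_self {s : N → N} {C : Set N}
    (hs : ∀ y, y ∉ C → s y = y) {x : M} (hx : x ∉ Φ '' C) : embTransport Φ s x = x := by
  by_cases hxt : x ∈ Φ.target
  · rw [embTransport_of_mem s hxt]
    have hC : Φ.symm x ∉ C := fun h => hx ⟨Φ.symm x, h, Φ.right_inv hxt⟩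
    rw [hs _ hC, Φ.right_inv hxt]
  · exact embTransport_of_not_mem s hxt

/-- Transports of mutually inverse maps are mutually inverse. [folklore] -/
theorem embTransport_embTransport (hΦ : Φ.source = univ) {s t : N → N}
    (hst : ∀ y, t (s y) = y) (x : M) : embTransport Φ t (embTransport Φ s x) = x := by
  by_cases hxt : x ∈ Φ.target
  · rw [embTransport_of_mem s hxt, embTransport_apply_coe hΦ, hst, Φ.right_inv hxt]
  · rw [embTransport_of_not_mem s hxt, embTransport_of_not_mem t hxt]

/-- **The transport of a smooth compactly supported self-map along a smooth open embedding is
smooth** (it is `Φ ∘ s ∘ Φ⁻¹` near the image and the identity near the closed complement of the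
image of the support). [folklore] -/
theorem contMDiff_embTransport [T2Space M] (hΦ : Φ.source = univ)
    (hΦs : ContMDiffOn J I ∞ Φ Φ.source) (hΦs' : ContMDiffOn I J ∞ Φ.symm Φ.target)
    {s : N → N} (hsm : ContMDiff J J ∞ s) {C : Set N} (hC : IsCompact C)
    (hs : ∀ y, y ∉ C → s y = y) : ContMDiff I I ∞ (embTransport Φ s) := by
  intro x
  by_cases hxt : x ∈ Φ.target
  · have hev : embTransport Φ s =ᶠ[𝓝 x] fun z => Φ (s (Φ.symm z)) :=
      Filter.eventuallyEq_of_mem (Φ.open_target.mem_nhds hxt) fun z hz => embTransport_of_mem s hz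
    refine ContMDiffAt.congr_of_eventuallyEq ?_ hev
    have h1 : ContMDiffAt I J ∞ Φ.symm x := hΦs'.contMDiffAt (Φ.open_target.mem_nhds hxt)
    have h2 : ContMDiffAt J I ∞ Φ (s (Φ.symm x)) :=
      hΦs.contMDiffAt (by rw [hΦ]; exact Filter.univ_mem)
    exact h2.comp x (hsm.contMDiffAt.comp x h1)
  · have hK : IsClosed (Φ '' C) := by
      refine (hC.image_of_continuousOn (Φ.continuousOn.mono ?_)).isClosed
      rw [hΦ]; exact subset_univ C
    have hxK : x ∉ Φ '' C := by
      rintro ⟨y, -, rfl⟩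
      exact hxt (Φ.map_source (hΦ ▸ mem_univ y))
    have hev : embTransport Φ s =ᶠ[𝓝 x] id :=
      Filter.eventuallyEq_of_mem (hK.isOpen_compl.mem_nhds hxK)
        fun z hz => embTransport_eq_self hs hz
    exact contMDiffAt_id.congr_of_eventuallyEq hev

/-- **Transport of a compactly supported diffeomorphism along a smooth open embedding with full
source**: `Φ ∘ s ∘ Φ⁻¹`, extended by the identity, is a diffeomorphism of `M` (static form of the
extension by the identity of a compactly supported diffeotopy; Hirsch, *Differential Topology*
(1976), Ch. 8 §1). [folklore] -/
def embTransportDiffeomorph [T2Space M] (Φ : OpenPartialHomeomorph N M) (hΦ : Φ.source = univ)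
    (hΦs : ContMDiffOn J I ∞ Φ Φ.source) (hΦs' : ContMDiffOn I J ∞ Φ.symm Φ.target)
    (s : N ≃ₘ⟮J, J⟯ N) {C : Set N} (hC : IsCompact C) (hs : ∀ y, y ∉ C → s y = y) :
    M ≃ₘ⟮I, I⟯ M where
  toFun := embTransport Φ s
  invFun := embTransport Φ s.symm
  left_inv := embTransport_embTransport hΦ s.symm_apply_apply
  right_inv := embTransport_embTransport hΦ s.apply_symm_apply
  contMDiff_toFun := contMDiff_embTransport hΦ hΦs hΦs' s.contMDiff hC hs
  contMDiff_invFun := contMDiff_embTransport hΦ hΦs hΦs' s.symm.contMDiff hC fun y hy => by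
    conv_lhs => rw [← hs y hy]
    exact s.symm_apply_apply y

/-- The transported diffeomorphism acts as the transport. [folklore] -/
@[simp] theorem embTransportDiffeomorph_apply [T2Space M] (Φ : OpenPartialHomeomorph N M)
    (hΦ : Φ.source = univ) (hΦs : ContMDiffOn J I ∞ Φ Φ.source)
    (hΦs' : ContMDiffOn I J ∞ Φ.symm Φ.target) (s : N ≃ₘ⟮J, J⟯ N) {C : Set N}
    (hC : IsCompact C) (hs : ∀ y, y ∉ C → s y = y) (x : M) :
    embTransportDiffeomorph Φ hΦ hΦs hΦs' s hC hs x = embTransport Φ s x := rfl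

end EmbTransport

/-! ### §5 Local diffeomorphisms from local agreement with a partial diffeomorphism -/

section LocalDiffeo

variable {EN HN EM HM : Type*} [NormedAddCommGroup EN] [NormedSpace ℝ EN] [TopologicalSpace HN]
  [NormedAddCommGroup EM] [NormedSpace ℝ EM] [TopologicalSpace HM]
  {I : ModelWithCorners ℝ EM HM} {J : ModelWithCorners ℝ EN HN}
  {M N : Type*} [TopologicalSpace M] [ChartedSpace HM M] [TopologicalSpace N] [ChartedSpace HN N]

/-- A map which agrees near `x` with an open partial homeomorphism `Φ ∋ x`, `C^n` with `C^n`
inverse, is a local diffeomorphism at `x`. [folklore] -/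
theorem isLocalDiffeomorphAt_of_eventuallyEq {n : WithTop ℕ∞} {f : M → N} {x : M}
    (Φ : OpenPartialHomeomorph M N) (hx : x ∈ Φ.source) (hΦ : ContMDiffOn I J n Φ Φ.source)
    (hΦ' : ContMDiffOn J I n Φ.symm Φ.target) (h : f =ᶠ[𝓝 x] Φ) :
    IsLocalDiffeomorphAt I J n f x := by
  obtain ⟨t, hts, hto, hxt⟩ := mem_nhds_iff.1 (Filter.eventuallyEq_iff_exists_mem.1 h).choose_spec.1
  have heq : EqOn f Φ t := fun y hy =>
    (Filter.eventuallyEq_iff_exists_mem.1 h).choose_spec.2 (hts hy)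
  set Ψ := Φ.restrOpen t hto with hΨ
  refine ⟨⟨Ψ.toPartialEquiv, Ψ.open_source, Ψ.open_target, ?_, ?_⟩, ⟨hx, hxt⟩, fun y hy => heq hy.2⟩
  · exact hΦ.mono inter_subset_left
  · exact hΦ'.mono inter_subset_left

end LocalDiffeo

/-! ### §6 The reflection as a linear isomorphism -/

section Reflect

variable {m : ℕ}

/-- The reflection in the boundary hyperplane is additive. [folklore] -/
theorem reflectZero_add (x y : 𝔼 (m + 1)) : reflectZero (x + y) = reflectZero x + reflectZero y := by
  ext i
  refine Fin.cases ?_ (fun j => ?_) i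
  · simp only [reflectZero_apply_zero, PiLp.add_apply, neg_add]
  · simp only [reflectZero_apply_succ, PiLp.add_apply]

/-- **The reflection in the boundary hyperplane as a continuous linear automorphism** of
`ℝᵐ⁺¹`. [folklore] -/
def reflectZeroCLE (m : ℕ) : 𝔼 (m + 1) ≃L[ℝ] 𝔼 (m + 1) :=
  LinearEquiv.toContinuousLinearEquiv
    { toFun := reflectZero
      invFun := reflectZero
      map_add' := reflectZero_add
      map_smul' := fun t y => reflectZero_smul t y
      left_inv := reflectZero_reflectZero
      right_inv := reflectZero_reflectZero }

/-- The linear automorphism acts as the reflection. [folklore] -/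
@[simp] theorem coe_reflectZeroCLE : ⇑(reflectZeroCLE m) = reflectZero := rfl

/-- The reflection is its own inverse. [folklore] -/
@[simp] theorem coe_reflectZeroCLE_symm : ⇑(reflectZeroCLE m).symm = reflectZero := rfl

/-- The reflection is smooth. [folklore] -/
theorem contMDiff_reflectZero :
    ContMDiff 𝓘(ℝ, 𝔼 (m + 1)) 𝓘(ℝ, 𝔼 (m + 1)) ∞ (reflectZero : 𝔼 (m + 1) → 𝔼 (m + 1)) :=
  (reflectZeroCLE m).contDiff.contMDiff

/-- The reflection does not change the tail. [folklore] -/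
@[simp] theorem tail_reflectZero (y : 𝔼 (m + 1)) : tail m (reflectZero y) = tail m y := by
  ext i
  simp only [tail, consCLE_symm_apply_fst_apply, reflectZero_apply_succ]

end Reflect

/-! ### §7 The main theorem: seam-adapted witnesses exist -/

section Main

universe u v

variable {n : ℕ} {A B : Type u} {X : Type v}
  [TopologicalSpace A] [ChartedSpace (ℍ (n + 2)) A] [IsManifold (𝓡∂ (n + 2)) ∞ A]
  [TopologicalSpace B] [T2Space B] [ChartedSpace (ℍ (n + 2)) B] [IsManifold (𝓡∂ (n + 2)) ∞ B]
  [TopologicalSpace X] [T2Space X] [SecondCountableTopology X] [ChartedSpace (𝔼 (n + 2)) X]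
  [IsManifold (𝓡 (n + 2)) ∞ X]

/-- **Seam-adapted witnesses of a gluing along the boundary exist** (the content of the named
fact `Literature.Topology.FourManifolds.exists_seamAdaptedWitnesses`, with all data explicit and
without the compactness, separation and countability hypotheses on the pieces `A`, `B` that the
fact carries — only `B` Hausdorff and `X` Hausdorff second countable are used). Given witnesses `(jA, jB)` of
`X = A ∪_φ B` and half-discs `kA`, `kB` with `φ`-corresponding flat faces: bicollar the seam
along `jA ∘ kA` (`K`, `exists_seamBicollar`) and along `jB ∘ kB` (`K_B`); the comparison germ
`M₀ = K_B⁻¹ ∘ K ∘ r` (`r` the reflection in the hyperplane) is a two-sided flat collar germ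
(it fixes the hyperplane since the faces correspond, and carries the upper side to the upper
side since `K` sees `jA(A)` and `K_B` sees `jB(B)` exactly from above); by
`exists_halfSpaceDiffeomorph_of_flatCollarGerm` it agrees near the unit face with a compactly
supported diffeomorphism `Θ` of the half space fixing the hyperplane, whose transport
`β = kB ∘ Θ ∘ kB⁻¹ ∪ id` is a diffeomorphism of `B` fixing `∂B` pointwise. The new witnesses are
`(jA, jB ∘ β)` (same seam relation), and the straddling disc is `jA ∘ kA ∪ (jB ∘ β ∘ kB ∘ r)`
— equal to `K` near the seam, hence a smooth injective local diffeomorphism — reparametrised by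
the radial stretch `ℝᵐ ≅ B(0, 3)` (`Literature.Topology.FourManifolds.stretch`). Hirsch, *Differential Topology* (1976),
Ch. 8, §1, proof of Thm. 1.9 (with Thm. 1.8), and §2; Munkres, *Elementary Differential
Topology* (1966), §6. [cite: HirschDT1976, Ch. 8 §1, proof of Thm. 1.9 (with Thm. 1.8), pp. 181–182] -/
theorem exists_seamAdapted_of_isBoundaryGluing
    (bA : BoundaryData (𝓡∂ (n + 2)) A (𝓡 (n + 1))) (bB : BoundaryData (𝓡∂ (n + 2)) B (𝓡 (n + 1)))
    (φ : bA.carrier ≃ₘ⟮𝓡 (n + 1), 𝓡 (n + 1)⟯ bB.carrier)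
    (kA : ℍ (n + 2) → A) (kB : ℍ (n + 2) → B) (fA : 𝔼 (n + 1) → bA.carrier)
    (hX : IsBoundaryGluing bA bB φ (𝓡 (n + 2)) X)
    (hkA : Manifold.IsSmoothEmbedding (𝓡∂ (n + 2)) (𝓡∂ (n + 2)) ∞ kA) (hkAo : IsOpen (range kA))
    (hkB : Manifold.IsSmoothEmbedding (𝓡∂ (n + 2)) (𝓡∂ (n + 2)) ∞ kB) (hkBo : IsOpen (range kB))
    (hfa : ∀ x', kA (EuclideanHalfSpace.face x') = bA.incl (fA x'))
    (hfb : ∀ x', kB (EuclideanHalfSpace.face x') = bB.incl (φ (fA x'))) :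
    ∃ (jA : A → X) (jB : B → X) (i : 𝔼 (n + 2) → X),
      Manifold.IsSmoothEmbedding (𝓡∂ (n + 2)) (𝓡 (n + 2)) ∞ jA ∧
      Manifold.IsSmoothEmbedding (𝓡∂ (n + 2)) (𝓡 (n + 2)) ∞ jB ∧
      range jA ∪ range jB = univ ∧
      (∀ a b, jA a = jB b ↔ ∃ z, a = bA.incl z ∧ b = bB.incl (φ z)) ∧
      Manifold.IsSmoothEmbedding 𝓘(ℝ, 𝔼 (n + 2)) (𝓡 (n + 2)) ∞ i ∧ IsOpen (range i) ∧
      (∀ x : ℍ (n + 2), ‖x.val‖ ≤ 1 → i x.val = jA (kA x)) ∧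
      (∀ x : ℍ (n + 2), ‖x.val‖ ≤ 1 → i (reflectZero x.val) = jB (kB x)) := by
  obtain ⟨jA, jB, hjA, hjB, hcov, hrel⟩ := hX
  have h0cont : Continuous fun w : 𝔼 (n + 2) => w 0 := FlatCollar.contDiff_apply_zero.continuous
  have hRs := contMDiff_reflectZero (m := n + 1)
  -- basic facts on the seam
  have hGinj : Injective fun x => jA (kA x) :=
    hjA.isEmbedding.injective.comp hkA.isEmbedding.injective
  have hkA_face : ∀ x : ℍ (n + 2), kA x ∈ range bA.incl ↔ x.val 0 = 0 := fun x => by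
    rw [bA.range_incl]; exact halfDisc_mem_boundary_iff hkA hkAo x
  have hkB_face : ∀ x : ℍ (n + 2), kB x ∈ range bB.incl ↔ x.val 0 = 0 := fun x => by
    rw [bB.range_incl]; exact halfDisc_mem_boundary_iff hkB hkBo x
  have hseam : ∀ x : ℍ (n + 2), x.val 0 = 0 → jA (kA x) = jB (kB x) := fun x hx => by
    rw [← EuclideanHalfSpace.face_hsTail_of_apply_zero x hx, hfa, hfb]
    exact (hrel _ _).2 ⟨fA (hsTail x), rfl, rfl⟩
  -- Step 1: the two bicollars of the seam
  obtain ⟨K, hKsrc, hKs, hKs', hKG, hKabove⟩ :=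
    exists_seamBicollar hjA hkA hkAo (r := 5) (by norm_num)
  obtain ⟨KB, hKBsrc, hKBs, hKBs', hKBG, hKBabove⟩ :=
    exists_seamBicollar hjB hkB hkBo (r := 5) (by norm_num)
  -- Step 2: the comparison germ `M₀ = K_B⁻¹ ∘ K ∘ r`
  set R := (reflectZeroCLE (n + 1)).toHomeomorph.toOpenPartialHomeomorph with hR
  set M₀ := ((OpenPartialHomeomorph.ofSet KB.source KB.open_source ≫ₕ R) ≫ₕ K) ≫ₕ KB.symm
    with hM₀
  have hM₀_apply : ∀ w, M₀ w = KB.symm (K (reflectZero w)) := fun w => rfl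
  have hM₀_symm_apply : ∀ y, M₀.symm y = reflectZero (K.symm (KB y)) := fun y => rfl
  have hM₀_source : ∀ w, w ∈ M₀.source ↔
      w ∈ KB.source ∧ reflectZero w ∈ K.source ∧ K (reflectZero w) ∈ KB.target := fun w => by
    simp [hM₀, hR, and_assoc]
  have hM₀_target : ∀ y, y ∈ M₀.target → y ∈ KB.source ∧ KB y ∈ K.target := fun y hy => by
    simp [hM₀, hR] at hy
    exact ⟨hy.1, hy.2.1⟩
  have hM₀s : ContDiffOn ℝ ∞ M₀ M₀.source := by
    rw [← contMDiffOn_iff_contDiffOn]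
    have h1 : ContMDiffOn 𝓘(ℝ, 𝔼 (n + 2)) (𝓡 (n + 2)) ∞ (fun w => K (reflectZero w)) M₀.source :=
      hKs.comp hRs.contMDiffOn fun w hw => ((hM₀_source w).1 hw).2.1
    exact (hKBs'.comp h1 fun w hw => ((hM₀_source w).1 hw).2.2).congr fun w _ => hM₀_apply w
  have hM₀s' : ContDiffOn ℝ ∞ M₀.symm M₀.target := by
    rw [← contMDiffOn_iff_contDiffOn]
    have h1 : ContMDiffOn (𝓡 (n + 2)) 𝓘(ℝ, 𝔼 (n + 2)) ∞ (fun y => K.symm (KB y)) M₀.target :=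
      hKs'.comp (hKBs.mono fun y hy => (hM₀_target y hy).1) fun y hy => (hM₀_target y hy).2
    exact (hRs.comp_contMDiffOn h1).congr fun y _ => hM₀_symm_apply y
  -- the germ hypotheses, with `R₀ = 3`
  have hdisc : {w : 𝔼 (n + 2) | w 0 = 0 ∧ ‖tail (n + 1) w‖ ≤ 3 + 2} ⊆ M₀.source := by
    rintro w ⟨hw0, hw⟩
    have hnorm : ‖w‖ ≤ 5 := by
      have h := norm_le_abs_add_norm_tail w
      rw [hw0, abs_zero, zero_add] at h
      linarith
    have hwKB : w ∈ KB.source := hKBsrc ⟨le_of_eq hw0.symm, hnorm⟩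
    have hwK : w ∈ K.source := hKsrc ⟨le_of_eq hw0.symm, hnorm⟩
    have hrw : reflectZero w = w := reflectZero_of_apply_zero hw0
    refine (hM₀_source w).2 ⟨hwKB, by rw [hrw]; exact hwK, ?_⟩
    rw [hrw, hKG ⟨w, le_of_eq hw0.symm⟩ hwK, hseam ⟨w, _⟩ hw0, ← hKBG ⟨w, le_of_eq hw0.symm⟩ hwKB]
    exact KB.map_source hwKB
  have hfix : ∀ w ∈ M₀.source, w 0 = 0 → M₀ w = w := by
    intro w hw hw0
    obtain ⟨hwKB, hwK, -⟩ := (hM₀_source w).1 hw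
    have hrw : reflectZero w = w := reflectZero_of_apply_zero hw0
    rw [hrw] at hwK
    rw [hM₀_apply, hrw, hKG ⟨w, le_of_eq hw0.symm⟩ hwK, hseam ⟨w, _⟩ hw0,
      ← hKBG ⟨w, le_of_eq hw0.symm⟩ hwKB]
    exact KB.left_inv hwKB
  have hpos : ∀ w ∈ M₀.source, 0 < w 0 → 0 < M₀ w 0 := by
    intro w hw hw0
    obtain ⟨-, hwK, hwT⟩ := (hM₀_source w).1 hw
    have hz0 : reflectZero w 0 < 0 := by rw [reflectZero_apply_zero]; linarith
    have hnotA : K (reflectZero w) ∉ range jA := fun h => (not_le.2 hz0) (hKabove _ hwK h)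
    have hinB : K (reflectZero w) ∈ range jB := by
      have h : K (reflectZero w) ∈ range jA ∪ range jB := by rw [hcov]; exact mem_univ _
      exact h.resolve_left hnotA
    set w' := KB.symm (K (reflectZero w)) with hw'
    have hw's : w' ∈ KB.source := KB.map_target hwT
    have hKBw' : KB w' = K (reflectZero w) := KB.right_inv hwT
    have hnn : 0 ≤ w' 0 := hKBabove w' hw's (by rw [hKBw']; exact hinB)
    rw [hM₀_apply]
    refine lt_of_le_of_ne hnn fun h0 => hnotA ?_
    rw [← hKBw', hKBG ⟨w', hnn⟩ hw's, ← hseam ⟨w', hnn⟩ h0.symm]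
    exact mem_range_self _
  obtain ⟨Θ, η₁, ρ, hη₁, hΘM₀, hΘfar, hΘfix⟩ :=
    exists_halfSpaceDiffeomorph_of_flatCollarGerm M₀ hM₀s hM₀s' (by norm_num : (0 : ℝ) < 3)
      hdisc hfix hpos
  -- Step 3: the diffeomorphism `β` of `B`
  haveI : Nonempty (ℍ (n + 2)) := ⟨0⟩
  set Φ := openEmbeddingChart hkB hkBo with hΦ
  have hΦsrc : Φ.source = univ := openEmbeddingChart_source hkB hkBo
  set C : Set (ℍ (n + 2)) := {y | ‖y.val‖ ≤ ρ} with hC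
  have hCc : IsCompact C := isCompact_halfSpace_norm_le ρ
  have hΘC : ∀ y, y ∉ C → Θ y = y := fun y hy => hΘfar y (le_of_lt (not_le.1 hy))
  set β := embTransportDiffeomorph Φ hΦsrc (contMDiffOn_openEmbeddingChart hkB hkBo)
    (contMDiffOn_openEmbeddingChart_symm hkB hkBo) Θ hCc hΘC with hβ
  have hβ_kB : ∀ y, β (kB y) = kB (Θ y) := fun y => embTransport_apply_coe hΦsrc Θ y
  have hβ_incl : ∀ z, β (bB.incl z) = bB.incl z := by
    intro z
    by_cases hz : bB.incl z ∈ range kB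
    · obtain ⟨y, hy⟩ := hz
      have hy0 : y.val 0 = 0 := (hkB_face y).1 ⟨z, hy.symm⟩
      rw [← hy, hβ_kB, hΘfix y hy0]
    · show embTransport Φ Θ (bB.incl z) = _
      exact embTransport_of_not_mem _ (by rwa [hΦ, openEmbeddingChart_target])
  -- Step 4: the new witness `jB' = jB ∘ β`
  set jB' : B → X := jB ∘ β with hjB'_def
  have hjB' : Manifold.IsSmoothEmbedding (𝓡∂ (n + 2)) (𝓡 (n + 2)) ∞ jB' :=
    hjB.comp_diffeomorph β
  have hβsurj : Surjective (β : B → B) := β.surjective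
  have hβinj : Injective (β : B → B) := β.injective
  have hcov' : range jA ∪ range jB' = univ := by
    rw [hjB'_def, hβsurj.range_comp]; exact hcov
  have hrel' : ∀ a b, jA a = jB' b ↔ ∃ z, a = bA.incl z ∧ b = bB.incl (φ z) := by
    intro a b
    rw [hjB'_def, comp_apply, hrel]
    constructor
    · rintro ⟨z, ha, hb⟩
      exact ⟨z, ha, hβinj (show β b = β (bB.incl (φ z)) by rw [hb, hβ_incl])⟩
    · rintro ⟨z, ha, hb⟩
      exact ⟨z, ha, by rw [hb, hβ_incl]⟩
  -- Step 5: the straddling disc before reparametrisation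
  set i₀ : 𝔼 (n + 2) → X := fun w =>
    if h : 0 ≤ w 0 then jA (kA ⟨w, h⟩)
    else jB' (kB ⟨reflectZero w, reflectZero_mem_halfSpace (le_of_lt (not_le.1 h))⟩) with hi₀_def
  have hi₀_up : ∀ x : ℍ (n + 2), i₀ x.val = jA (kA x) := fun x => by
    simp only [hi₀_def, dif_pos x.2, Subtype.coe_eta]
  have hi₀_down' : ∀ (w : 𝔼 (n + 2)) (hw : w 0 < 0),
      i₀ w = jB' (kB ⟨reflectZero w, reflectZero_mem_halfSpace hw.le⟩) := fun w hw => by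
    simp only [hi₀_def, dif_neg (not_le.2 hw)]
  have hi₀_down : ∀ x : ℍ (n + 2), i₀ (reflectZero x.val) = jB' (kB x) := by
    intro x
    rcases (x.2 : 0 ≤ x.val 0).lt_or_eq with h | h
    · have h' : reflectZero x.val 0 < 0 := by rw [reflectZero_apply_zero]; linarith
      rw [hi₀_down' _ h']
      congr 2
      exact Subtype.ext (reflectZero_reflectZero x.val)
    · rw [reflectZero_of_apply_zero h.symm, hi₀_up, hjB'_def, comp_apply, hβ_kB, hΘfix x h.symm]
      exact hseam x h.symm
  -- injectivity of `i₀`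
  have hmixed : ∀ w₁ w₂ : 𝔼 (n + 2), 0 ≤ w₁ 0 → w₂ 0 < 0 → i₀ w₁ ≠ i₀ w₂ := by
    intro w₁ w₂ h₁ h₂ h
    set y₂ : ℍ (n + 2) := ⟨reflectZero w₂, reflectZero_mem_halfSpace h₂.le⟩ with hy₂
    have e1 : i₀ w₁ = jA (kA ⟨w₁, h₁⟩) := hi₀_up ⟨w₁, h₁⟩
    have e2 : i₀ w₂ = jB' (kB y₂) := hi₀_down' w₂ h₂
    rw [e1, e2] at h
    obtain ⟨z, -, hz⟩ := (hrel' (kA ⟨w₁, h₁⟩) (kB y₂)).1 h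
    have h0 : y₂.val 0 = 0 := (hkB_face y₂).1 ⟨φ z, hz.symm⟩
    have h0' : reflectZero w₂ 0 = 0 := h0
    rw [reflectZero_apply_zero] at h0'
    linarith
  have hi₀_inj : Injective i₀ := by
    intro w₁ w₂ h
    by_cases h₁ : 0 ≤ w₁ 0 <;> by_cases h₂ : 0 ≤ w₂ 0
    · have e1 : i₀ w₁ = jA (kA ⟨w₁, h₁⟩) := hi₀_up ⟨w₁, h₁⟩
      have e2 : i₀ w₂ = jA (kA ⟨w₂, h₂⟩) := hi₀_up ⟨w₂, h₂⟩
      rw [e1, e2] at h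
      exact congrArg Subtype.val (hGinj h)
    · exact absurd h (hmixed w₁ w₂ h₁ (not_le.1 h₂))
    · exact absurd h.symm (hmixed w₂ w₁ h₂ (not_le.1 h₁))
    · have e1 : i₀ w₁ = jB' (kB ⟨reflectZero w₁, reflectZero_mem_halfSpace (not_le.1 h₁).le⟩) :=
        hi₀_down' w₁ (not_le.1 h₁)
      have e2 : i₀ w₂ = jB' (kB ⟨reflectZero w₂, reflectZero_mem_halfSpace (not_le.1 h₂).le⟩) :=
        hi₀_down' w₂ (not_le.1 h₂)
      rw [e1, e2] at h
      have h' := congrArg Subtype.val (hkB.isEmbedding.injective (hjB'.isEmbedding.injective h))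
      have h'' : reflectZero w₁ = reflectZero w₂ := h'
      rw [← reflectZero_reflectZero w₁, h'', reflectZero_reflectZero]
  -- `i₀` is a local diffeomorphism at the points of the ball of radius `3`
  have hi₀_loc : ∀ w : 𝔼 (n + 2), ‖w‖ < 3 →
      IsLocalDiffeomorphAt 𝓘(ℝ, 𝔼 (n + 2)) (𝓡 (n + 2)) ∞ i₀ w := by
    intro w hw
    rcases lt_trichotomy (w 0) 0 with h0 | h0 | h0
    · -- lower point: a seam chart of `(jB', kB)` at the reflected point
      set y₀ : ℍ (n + 2) := ⟨reflectZero w, reflectZero_mem_halfSpace h0.le⟩ with hy₀_def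
      obtain ⟨K', hy₀, -, hK's, hK's', hK'G, -⟩ := exists_seamChart hjB' hkB hkBo y₀ one_pos
      refine isLocalDiffeomorphAt_of_eventuallyEq (R ≫ₕ K') ⟨mem_univ _, hy₀⟩ ?_ ?_ ?_
      · exact hK's.comp hRs.contMDiffOn fun z hz => hz.2
      · exact hRs.comp_contMDiffOn (hK's'.mono inter_subset_left)
      · have hO : IsOpen ({z : 𝔼 (n + 2) | z 0 < 0} ∩ reflectZero ⁻¹' K'.source) :=
          (isOpen_lt h0cont continuous_const).inter (K'.open_source.preimage hRs.continuous)
        filter_upwards [hO.mem_nhds ⟨h0, hy₀⟩] with z hz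
        rw [hi₀_down' z hz.1]
        exact (hK'G ⟨reflectZero z, _⟩ hz.2).symm
    · -- seam point: `i₀ = K` near `w`
      have hwt : ‖tail (n + 1) w‖ < 3 := (FlatCollar.norm_tail_le w).trans_lt hw
      have hwK : w ∈ K.source := hKsrc ⟨h0.ge, by linarith [hw.le]⟩
      refine isLocalDiffeomorphAt_of_eventuallyEq K hwK hKs hKs' ?_
      have hO : IsOpen (K.source ∩ {z : 𝔼 (n + 2) | |z 0| < η₁} ∩
          {z : 𝔼 (n + 2) | ‖tail (n + 1) z‖ < 3}) :=
        (K.open_source.inter (isOpen_lt (continuous_abs.comp h0cont) continuous_const)).inter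
          (isOpen_lt (continuous_norm.comp (continuous_tail (n + 1))) continuous_const)
      have hwO : w ∈ K.source ∩ {z : 𝔼 (n + 2) | |z 0| < η₁} ∩
          {z : 𝔼 (n + 2) | ‖tail (n + 1) z‖ < 3} :=
        ⟨⟨hwK, by show |w 0| < η₁; rw [h0, abs_zero]; exact hη₁⟩, hwt⟩
      filter_upwards [hO.mem_nhds hwO] with z hz
      obtain ⟨⟨hzK, hzη⟩, hzt⟩ := hz
      rcases le_or_gt 0 (z 0) with hz0 | hz0
      · exact (hi₀_up ⟨z, hz0⟩).trans (hKG ⟨z, hz0⟩ hzK).symm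
      · set y : ℍ (n + 2) := ⟨reflectZero z, reflectZero_mem_halfSpace hz0.le⟩ with hy
        have hzη' : |z 0| < η₁ := hzη
        have hy1 : y.val 0 ≤ η₁ := by
          show reflectZero z 0 ≤ η₁
          rw [reflectZero_apply_zero]; linarith [(abs_lt.1 hzη').1]
        have hy2 : ‖tail (n + 1) y.val‖ ≤ 3 := by
          show ‖tail (n + 1) (reflectZero z)‖ ≤ 3
          rw [tail_reflectZero]; exact hzt.le
        obtain ⟨hys, hΘy⟩ := hΘM₀ y hy1 hy2
        obtain ⟨-, -, hyT⟩ := (hM₀_source _).1 hys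
        have hrr : reflectZero y.val = z := reflectZero_reflectZero z
        rw [hi₀_down' z hz0, hjB'_def, comp_apply]
        change jB (β (kB y)) = K z
        have hΘys : (Θ y).val ∈ KB.source := by rw [hΘy, hM₀_apply]; exact KB.map_target hyT
        rw [hβ_kB, ← hKBG (Θ y) hΘys, hΘy, hM₀_apply, KB.right_inv hyT, hrr]
    · -- upper interior point: `i₀ = K` near `w`
      have hwK : w ∈ K.source := hKsrc ⟨h0.le, by linarith [hw.le]⟩
      refine isLocalDiffeomorphAt_of_eventuallyEq K hwK hKs hKs' ?_
      have hO : IsOpen ({z : 𝔼 (n + 2) | 0 < z 0} ∩ K.source) :=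
        (isOpen_lt continuous_const h0cont).inter K.open_source
      filter_upwards [hO.mem_nhds ⟨h0, hwK⟩] with z hz
      exact (hi₀_up ⟨z, hz.1.le⟩).trans (hKG ⟨z, hz.1.le⟩ hz.2).symm
  -- Step 6: the disc `i = i₀ ∘ stretch`
  set i : 𝔼 (n + 2) → X := i₀ ∘ stretch with hi_def
  have hstretch : ∀ z : 𝔼 (n + 2), IsLocalDiffeomorphAt 𝓘(ℝ, 𝔼 (n + 2)) 𝓘(ℝ, 𝔼 (n + 2)) ∞
      (stretch : 𝔼 (n + 2) → 𝔼 (n + 2)) z := fun z =>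
    isLocalDiffeomorphAt_of_eventuallyEq stretchPartialHomeomorph (by simp)
      (contMDiffOn_iff_contDiffOn.2 contDiffOn_stretchPartialHomeomorph.1)
      (contMDiffOn_iff_contDiffOn.2 contDiffOn_stretchPartialHomeomorph.2)
      (Filter.EventuallyEq.of_eq stretchPartialHomeomorph_coe.symm)
  have hi_loc : IsLocalDiffeomorph 𝓘(ℝ, 𝔼 (n + 2)) (𝓡 (n + 2)) ∞ i := fun z =>
    IsLocalDiffeomorphAt.comp (hf := hstretch z) (hg := hi₀_loc (stretch z) (norm_stretch_lt z))
  have hi_inj : Injective i := hi₀_inj.comp injective_stretch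
  have hi : Manifold.IsSmoothEmbedding 𝓘(ℝ, 𝔼 (n + 2)) (𝓡 (n + 2)) ∞ i :=
    isSmoothEmbedding_of_isLocalDiffeomorph hi_loc hi_inj (ContinuousLinearEquiv.refl ℝ _)
  refine ⟨jA, jB', i, hjA, hjB', hcov', hrel', hi, hi_loc.isOpen_range, fun x hx => ?_,
    fun x hx => ?_⟩
  · rw [hi_def, comp_apply, stretch_eq_self hx, hi₀_up]
  · rw [hi_def, comp_apply, stretch_eq_self (by rwa [norm_reflectZero]), hi₀_down]

/-- **Discharge of the named fact `Literature.Topology.FourManifolds.exists_seamAdaptedWitnesses`** (`CorkDecompositionSplittingProof.lean`,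
§1): gluing witnesses may be chosen adapted to a pair of half-discs with corresponding flat faces
— the compatibility (uniqueness) of collars, Hirsch, *Differential Topology* (1976), Ch. 8, §1,
proof of Thm. 1.9 with Thm. 1.8, and §2; Munkres, *Elementary Differential Topology* (1966), §6.
[cite: HirschDT1976, Ch. 8 §1, proof of Thm. 1.9 (with Thm. 1.8), pp. 181–182] -/
theorem exists_seamAdaptedWitnesses_holds : exists_seamAdaptedWitnesses.{u, v} := by
  intro n A B X _ _ _ _ _ _ _ _ _ _ _ _ _ _ _ _ _ bA bB φ kA kB fA hX hkA hkAo hkB hkBo hfa hfb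
  exact exists_seamAdapted_of_isBoundaryGluing bA bB φ kA kB fA hX hkA hkAo hkB hkBo hfa hfb

/-- **The cork decomposition theorem from Matveyev's part 1 and "Fact" alone.** With the seam
adaptation discharged, the named fact `Literature.Topology.FourManifolds.corkDecomposition`
(`CorkTwist.lean`: h-cobordant simply connected closed smooth 4-manifolds differ by a cork twist
along a compact contractible `C`; Curtis–Freedman–Hsiang–Stong 1996, Matveyev 1996) follows from
the single named fact `Literature.Topology.FourManifolds.Matveyev1996_partOne_and_fact`
(`CorkDecomposition.lean` §4: part 1 of Matveyev's Theorem — the two-piece decomposition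
`X₁ = W₁ ∪_Σ M`, `X₂ = W₂ ∪_Σ M` with `Wᵢ` compact contractible — together with the "Fact"
`W₁ ∪_Σ W₁ ≅ S⁴ ≅ W₁ ∪_Σ W₂` of the proof of part 2), every other step of Matveyev's proof
(fig. 2, boundary connected sums, `X # S⁴ ≅ X`, collars, seam adaptation) being proved in the
tree (`corkDecomposition_of_partOne_fact_seamAdapted`, `CorkDecompositionSplittingProof.lean`).
[cite: Matveyev1996, Theorem (Introduction), parts 1–2, and proof of part 2 (arXiv pp. 1–3)] -/
theorem corkDecomposition_of_partOne_and_fact (hB : Matveyev1996_partOne_and_fact.{u}) :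
    corkDecomposition.{u} :=
  corkDecomposition_of_partOne_fact_seamAdapted hB exists_seamAdaptedWitnesses_holds
    exists_seamAdaptedWitnesses_holds

end Main

end Literature.Topology.FourManifolds

end
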